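import Summits.ValiantsHypothesis.ValiantsHypothesis.Theorems.LacunarySymmetroidMatrixDescartesVLawCore

/-!
# `MatrixDescartes` (stmt-ValiantsHypothesis-18050), line `Lift` — the STAR core lemma with SAME-SIDE letters
# (Stieltjes factorisation through a letter with companions at gap ratio in `(1, 2)`)

HONEST FRAMING.  Cell `pub-symmetroid`, seat `val-sym-mdr-p2` (gen 2); helper `--supports` the crux
`Theses.LacunarySymmetroid.MatrixDescartes`, NO closure claim.  Extension of `…VLawCore.lean` (Lemma FULL of
`VLAW-PROOF.md`, STAR form) used by `…FanLawTwo.lean`; nothing here bears on `stub_twoSided`, the crux in its window,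
`DoorA26`/`DoorA34`, or `VP ≠ VNP`.

THE OBSERVATION.  In the Gram decomposition of `…VLawCore` the factoring letter `P` (gap `a`, weight `w = u^{-a}`) may
be accompanied not only by letters on the OPPOSITE side of the pivot with gaps `b < a` (functions `w ↦ w^{-b/a}`,
Stieltjes, kernel weight `ρ^{a-1-b}`) but also by letters on the SAME side with gaps `c ∈ (a, 2a)`: the function
`w ↦ w^{c/a}` with `1 < c/a < 2` is `C⁻¹ ∫ w²/(w+ρ^a) ρ^{c-a-1} dρ` (rpow-free by the same substitution), and the second
divided differences of `w²/(w+σ)` are `σ²/((w_i+σ)(w_j+σ)(w_s+σ))` — again a positive mixture of rank-one kernels.  So the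
STAR CORE LEMMA holds for the H-form `H(u) = J + (u^a)⁻¹P + ∑ l, u^{b l} Q l + ∑ m, (u^{c m})⁻¹ R m` with `0 < b l < a`
and `a < c m < 2a` (`core_pos₂`): kernel vectors at distinct nodes, a target `s` towards which every node's Rayleigh
slope points, nondegeneracy ⇒ `H(s)` is positive on the span.  (Ratios `γ = b/a` of signed gaps with PSD second-
difference kernel are exactly `γ ∈ [-1,0) ∪ [1,2]`; the open conditions are used so that strictness follows by partial
fractions.)  New ingredients over `…VLawCore`: the same-side entry integrals `offdiag_integral₂` / `diag_integral₂`
(partial fractions of `w² (w+σ)⁻¹`) and the bookkeeping over the disjoint union of the two letter families.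
[folklore] Löwner-type kernel positivity; elementary given `…VLawStieltjes` / `…VLawNormalForm` / `…VLawCore`.
-/

-- layout Summits/ValiantsHypothesis/ValiantsHypothesis forces the duplicated namespace component
set_option linter.dupNamespace false

namespace Summit.ValiantsHypothesis.ValiantsHypothesis.Theorems.LacunarySymmetroidMatrixDescartes

open MeasureTheory Set Filter Topology Matrix Finset
open scoped BigOperators
open VLawNormalForm VLawCore

namespace VLawCoreTwo

/-! ## Same-side kernel integrals (weight `ρ^n · ρ^{2a}`) -/

section Integrals

/-- **Same-side off-diagonal kernel integral.**  With `I_w = ∫ ρ^n/(w+ρ^a) = g_w · C`: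
`(q−p)(t−p)(t−q) · ∫ ρ^n r_t (ρ^a r_p)(ρ^a r_q) = C · ((t−q) p² g_p − (t−p) q² g_q + (q−p) t² g_t)`
(partial fractions of `w²(w+σ)⁻¹`). [folklore] -/
theorem offdiag_integral₂ {n a : ℕ} (hna : n + 2 ≤ a) {p q t : ℝ} (hp : 0 < p) (hq : 0 < q) (ht : 0 < t)
    {gp gq gt C : ℝ} (ep : ∫ ρ in Ioi (0:ℝ), ρ ^ n / (p + ρ ^ a) = gp * C)
    (eq : ∫ ρ in Ioi (0:ℝ), ρ ^ n / (q + ρ ^ a) = gq * C) (et : ∫ ρ in Ioi (0:ℝ), ρ ^ n / (t + ρ ^ a) = gt * C) :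
    (q - p) * (t - p) * (t - q) * ∫ ρ in Ioi (0:ℝ), ρ ^ n / (t + ρ ^ a)
        * ((ρ ^ a * (p + ρ ^ a)⁻¹) * (ρ ^ a * (q + ρ ^ a)⁻¹))
      = C * ((t - q) * (p ^ 2 * gp) - (t - p) * (q ^ 2 * gq) + (q - p) * (t ^ 2 * gt)) := by
  have hIp := VLawStieltjes.integrableOn_stieltjes hna hp
  have hIq := VLawStieltjes.integrableOn_stieltjes hna hq
  have hIt := VLawStieltjes.integrableOn_stieltjes hna ht
  have hcongr : EqOn (fun ρ : ℝ => (q - p) * (t - p) * (t - q) * (ρ ^ n / (t + ρ ^ a)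
        * ((ρ ^ a * (p + ρ ^ a)⁻¹) * (ρ ^ a * (q + ρ ^ a)⁻¹))))
      (fun ρ => (t - q) * p ^ 2 * (ρ ^ n / (p + ρ ^ a)) - (t - p) * q ^ 2 * (ρ ^ n / (q + ρ ^ a))
        + (q - p) * t ^ 2 * (ρ ^ n / (t + ρ ^ a))) (Ioi 0) := by
    intro ρ hρ
    have h1 : p + ρ ^ a ≠ 0 := (VLawStieltjes.den_pos hp a hρ.out.le).ne'
    have h2 : q + ρ ^ a ≠ 0 := (VLawStieltjes.den_pos hq a hρ.out.le).ne'
    have h3 : t + ρ ^ a ≠ 0 := (VLawStieltjes.den_pos ht a hρ.out.le).ne'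
    simp only
    field_simp
    ring
  rw [← integral_const_mul, setIntegral_congr_fun measurableSet_Ioi hcongr,
    integral_add ((hIp.const_mul _).sub' (hIq.const_mul _)) (hIt.const_mul _),
    integral_sub (hIp.const_mul _) (hIq.const_mul _), integral_const_mul, integral_const_mul, integral_const_mul,
    ep, eq, et]
  ring

/-- **Same-side diagonal kernel integral.**  With `I_p = g_p C`, `I_t = g_t C`, `∫ ρ^n/(p+ρ^a)^2 = h_p C`:
`(t−p)^2 · ∫ ρ^n r_t (ρ^a r_p)^2 = C · (t² g_t − p² g_p − (t−p)(2p g_p − p² h_p))`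
(Taylor remainder of `w²(w+σ)⁻¹`, whose derivative is `2w(w+σ)⁻¹ − w²(w+σ)⁻²`). [folklore] -/
theorem diag_integral₂ {n a : ℕ} (hna : n + 2 ≤ a) {p t : ℝ} (hp : 0 < p) (ht : 0 < t) {gp gt hp2 C : ℝ}
    (ep : ∫ ρ in Ioi (0:ℝ), ρ ^ n / (p + ρ ^ a) = gp * C) (et : ∫ ρ in Ioi (0:ℝ), ρ ^ n / (t + ρ ^ a) = gt * C)
    (ep2 : ∫ ρ in Ioi (0:ℝ), ρ ^ n / (p + ρ ^ a) ^ 2 = hp2 * C) :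
    (t - p) ^ 2 * ∫ ρ in Ioi (0:ℝ), ρ ^ n / (t + ρ ^ a) * ((ρ ^ a * (p + ρ ^ a)⁻¹) * (ρ ^ a * (p + ρ ^ a)⁻¹))
      = C * (t ^ 2 * gt - p ^ 2 * gp - (t - p) * (2 * p * gp - p ^ 2 * hp2)) := by
  have hIp := VLawStieltjes.integrableOn_stieltjes hna hp
  have hIt := VLawStieltjes.integrableOn_stieltjes hna ht
  have hIp2 := VLawStieltjes.integrableOn_stieltjes_sq hna hp
  have hcongr : EqOn (fun ρ : ℝ => (t - p) ^ 2 * (ρ ^ n / (t + ρ ^ a)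
        * ((ρ ^ a * (p + ρ ^ a)⁻¹) * (ρ ^ a * (p + ρ ^ a)⁻¹))))
      (fun ρ => t ^ 2 * (ρ ^ n / (t + ρ ^ a)) - (p ^ 2 + (t - p) * (2 * p)) * (ρ ^ n / (p + ρ ^ a))
        + (t - p) * p ^ 2 * (ρ ^ n / (p + ρ ^ a) ^ 2)) (Ioi 0) := by
    intro ρ hρ
    have h1 : p + ρ ^ a ≠ 0 := (VLawStieltjes.den_pos hp a hρ.out.le).ne'
    have h3 : t + ρ ^ a ≠ 0 := (VLawStieltjes.den_pos ht a hρ.out.le).ne'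
    simp only
    field_simp
    ring
  rw [← integral_const_mul, setIntegral_congr_fun measurableSet_Ioi hcongr,
    integral_add ((hIt.const_mul _).sub' (hIp.const_mul _)) (hIp2.const_mul _),
    integral_sub (hIt.const_mul _) (hIp.const_mul _), integral_const_mul, integral_const_mul, integral_const_mul,
    ep, et, ep2]
  ring

/-- Pointwise: the same-side kernel integrand is `ρ^n r_t(ρ)` times the quadratic form of `R` at
`y'_ρ = ∑ i, (e i · ρ^a r_{w i}(ρ)) • v i`. [folklore] -/
theorem quadForm_y₂ {ι : Type*} [Fintype ι] {k : ℕ} (n a : ℕ) (w : Fin k → ℝ) (t : ℝ) (Rm : Matrix ι ι ℝ)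
    (v : Fin k → ι → ℝ) (e : Fin k → ℝ) (ρ : ℝ) :
    ∑ i, ∑ j, e i * e j * (v i ⬝ᵥ (Rm *ᵥ v j))
        * (ρ ^ n / (t + ρ ^ a) * ((ρ ^ a * (w i + ρ ^ a)⁻¹) * (ρ ^ a * (w j + ρ ^ a)⁻¹)))
      = ρ ^ n / (t + ρ ^ a) *
        ((∑ i, (e i * (ρ ^ a * (w i + ρ ^ a)⁻¹)) • v i)
          ⬝ᵥ (Rm *ᵥ ∑ j, (e j * (ρ ^ a * (w j + ρ ^ a)⁻¹)) • v j)) := by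
  rw [quadForm_sum_smul Rm (fun i => e i * (ρ ^ a * (w i + ρ ^ a)⁻¹)) v, Finset.mul_sum]
  refine Finset.sum_congr rfl fun i _ => ?_
  rw [Finset.mul_sum]
  refine Finset.sum_congr rfl fun j _ => ?_
  ring

/-- Every summand of the same-side kernel integrand is integrable on `(0, ∞)`. [folklore] -/
theorem integrableOn_kernel_term₂ {n a : ℕ} (hna : n + 2 ≤ a) {wi wj t : ℝ} (hwi : 0 < wi) (hwj : 0 < wj)
    (ht : 0 < t) (κ0 : ℝ) :
    IntegrableOn (fun ρ : ℝ => κ0 * (ρ ^ n / (t + ρ ^ a)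
      * ((ρ ^ a * (wi + ρ ^ a)⁻¹) * (ρ ^ a * (wj + ρ ^ a)⁻¹)))) (Ioi 0) := by
  refine Integrable.const_mul ?_ κ0
  have hcont : ∀ {w : ℝ}, 0 < w → ContinuousOn (fun ρ : ℝ => ρ ^ a * (w + ρ ^ a)⁻¹) (Ioi 0) := fun hw =>
    (continuousOn_pow a).mul ((VLawStieltjes.continuousOn_inv_den a hw).mono Ioi_subset_Ici_self)
  have hbd : ∀ {w : ℝ}, 0 < w → ∀ ρ : ℝ, 0 < ρ → 0 ≤ ρ ^ a * (w + ρ ^ a)⁻¹ ∧ ρ ^ a * (w + ρ ^ a)⁻¹ ≤ 1 := by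
    intro w hw ρ hρ
    have hden := VLawStieltjes.den_pos hw a hρ.le
    refine ⟨mul_nonneg (pow_nonneg hρ.le a) (inv_nonneg.2 hden.le), ?_⟩
    rw [← div_eq_mul_inv, div_le_one hden]
    linarith
  refine VLawStieltjes.integrableOn_stieltjes_mul hna ht ((hcont hwi).mul (hcont hwj)) (B := 1) fun ρ hρ => ?_
  have h1 := hbd hwi ρ hρ
  have h2 := hbd hwj ρ hρ
  rw [abs_of_nonneg (mul_nonneg h1.1 h2.1)]
  calc ρ ^ a * (wi + ρ ^ a)⁻¹ * (ρ ^ a * (wj + ρ ^ a)⁻¹) ≤ 1 * 1 :=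
        mul_le_mul h1.2 h2.2 h2.1 zero_le_one
    _ = 1 := one_mul 1

/-- **Interchange** of the finite double sum and the integral (same-side kernel). [folklore] -/
theorem integral_quadForm₂ {ι : Type*} [Fintype ι] {k n a : ℕ} (hna : n + 2 ≤ a) (w : Fin k → ℝ)
    (hw : ∀ i, 0 < w i) {t : ℝ} (ht : 0 < t) (Rm : Matrix ι ι ℝ) (v : Fin k → ι → ℝ) (e : Fin k → ℝ) :
    ∫ ρ in Ioi (0:ℝ), ∑ i, ∑ j, e i * e j * (v i ⬝ᵥ (Rm *ᵥ v j))
        * (ρ ^ n / (t + ρ ^ a) * ((ρ ^ a * (w i + ρ ^ a)⁻¹) * (ρ ^ a * (w j + ρ ^ a)⁻¹)))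
      = ∑ i, ∑ j, e i * e j * (v i ⬝ᵥ (Rm *ᵥ v j))
        * ∫ ρ in Ioi (0:ℝ), ρ ^ n / (t + ρ ^ a) * ((ρ ^ a * (w i + ρ ^ a)⁻¹) * (ρ ^ a * (w j + ρ ^ a)⁻¹)) := by
  rw [integral_finsetSum _ fun i _ => integrable_finsetSum _ fun j _ =>
    integrableOn_kernel_term₂ hna (hw i) (hw j) ht _]
  refine Finset.sum_congr rfl fun i _ => ?_
  rw [integral_finsetSum _ fun j _ => integrableOn_kernel_term₂ hna (hw i) (hw j) ht _]
  refine Finset.sum_congr rfl fun j _ => ?_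
  exact integral_const_mul _ _

/-- The same-side kernel integrand is continuous on `(0, ∞)`. [folklore] -/
theorem continuousOn_kernelSum₂ {k : ℕ} (n a : ℕ) {w : Fin k → ℝ} (hw : ∀ i, 0 < w i) {t : ℝ} (ht : 0 < t)
    (Rh : Fin k → Fin k → ℝ) (e : Fin k → ℝ) :
    ContinuousOn (fun ρ : ℝ => ∑ i, ∑ j, e i * e j * Rh i j
        * (ρ ^ n / (t + ρ ^ a) * ((ρ ^ a * (w i + ρ ^ a)⁻¹) * (ρ ^ a * (w j + ρ ^ a)⁻¹)))) (Ioi 0) := by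
  refine continuousOn_finsetSum _ fun i _ => continuousOn_finsetSum _ fun j _ => ?_
  refine ContinuousOn.mul continuousOn_const ?_
  refine ((VLawStieltjes.continuousOn_stieltjes n a ht).mono Ioi_subset_Ici_self).mul ?_
  exact ((continuousOn_pow a).mul ((VLawStieltjes.continuousOn_inv_den a (hw i)).mono Ioi_subset_Ici_self)).mul
    ((continuousOn_pow a).mul ((VLawStieltjes.continuousOn_inv_den a (hw j)).mono Ioi_subset_Ici_self))

end Integrals

/-! ## Entries of the compressed matrix for the two-family H-form -/

section Entries

variable {ι : Type*} [Fintype ι] {κ μ : Type*} [Fintype κ] [Fintype μ]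

omit [Fintype ι] in
/-- The two-family H-form as a one-family H-form over the disjoint union of the letter families. [folklore] -/
theorem hform₂_eq (J P : Matrix ι ι ℝ) (Q : κ → Matrix ι ι ℝ) (R : μ → Matrix ι ι ℝ) (w : ℝ)
    (gq : κ → ℝ) (gr : μ → ℝ) :
    J + w • P + ∑ l, gq l • Q l + ∑ m, gr m • R m
      = J + w • P + ∑ x : κ ⊕ μ, (Sum.elim gq gr x) • (Sum.elim Q R x) := by
  rw [Fintype.sum_sum_type, add_assoc]
  simp only [Sum.elim_inl, Sum.elim_inr]

/-- Power bookkeeping for a same-side letter: with `c + b' = 2a`, `u > 0`: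
`((u^a)⁻¹)² · u^{b'} = (u^c)⁻¹` and `2 (u^a)⁻¹ u^{b'} − ((u^a)⁻¹)² (b'/a) u^{a+b'} = (c/a) u^a (u^c)⁻¹`. [folklore] -/
theorem sameSide_pow {a c b' : ℕ} (ha : 0 < a) (hc : c + b' = 2 * a) {u : ℝ} (hu : 0 < u) :
    ((u ^ a)⁻¹) ^ 2 * u ^ b' = (u ^ c)⁻¹
    ∧ 2 * (u ^ a)⁻¹ * u ^ b' - ((u ^ a)⁻¹) ^ 2 * (((b' : ℝ) / a) * u ^ (a + b')) = ((c : ℝ) / a) * u ^ a * (u ^ c)⁻¹ := by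
  have hu0 : u ≠ 0 := hu.ne'
  have hua : u ^ a ≠ 0 := pow_ne_zero a hu0
  have huc : u ^ c ≠ 0 := pow_ne_zero c hu0
  have ha0 : (a : ℝ) ≠ 0 := by exact_mod_cast ha.ne'
  have hX : u ^ a * u ^ a = u ^ c * u ^ b' := by rw [← pow_add, ← pow_add, hc, two_mul]
  have hcast : (c : ℝ) = 2 * a - b' := by
    have : (c : ℝ) + b' = 2 * a := by exact_mod_cast hc
    linarith
  have hYZ : (u ^ a)⁻¹ * u ^ b' = u ^ a * (u ^ c)⁻¹ := by
    rw [inv_mul_eq_iff_eq_mul₀ hua, ← mul_assoc, eq_mul_inv_iff_mul_eq₀ huc, mul_comm (u ^ b')]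
    exact hX.symm
  constructor
  · rw [pow_two, mul_assoc, hYZ, ← mul_assoc, inv_mul_cancel₀ hua, one_mul]
  · calc 2 * (u ^ a)⁻¹ * u ^ b' - ((u ^ a)⁻¹) ^ 2 * (((b' : ℝ) / a) * u ^ (a + b'))
        = (2 - (b' : ℝ) / a) * ((u ^ a)⁻¹ * u ^ b') := by
          rw [pow_add]
          field_simp
      _ = ((c : ℝ) / a) * ((u ^ a)⁻¹ * u ^ b') := by
          rw [hcast]
          field_simp
      _ = ((c : ℝ) / a) * u ^ a * (u ^ c)⁻¹ := by rw [hYZ, mul_assoc]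

/-- **Off-diagonal entry, two families.** [folklore] -/
theorem entry_offdiag₂ {a : ℕ} (ha : 0 < a) {b n : κ → ℕ} (hnb : ∀ l, n l + b l + 1 = a) (hb : ∀ l, 0 < b l)
    {c n' b' : μ → ℕ} (hnb' : ∀ m, n' m + b' m + 1 = a) (hb' : ∀ m, 0 < b' m) (hc : ∀ m, c m + b' m = 2 * a)
    {J P : Matrix ι ι ℝ} {Q : κ → Matrix ι ι ℝ} {R : μ → Matrix ι ι ℝ} (hJ : J.IsSymm) (hP : P.IsSymm)
    (hQ : ∀ l, (Q l).IsSymm) (hR : ∀ m, (R m).IsSymm) {ui uj s : ℝ} (hui : 0 < ui) (huj : 0 < uj) (hs : 0 < s)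
    (hij : ui ≠ uj) {vi vj : ι → ℝ}
    (hi : (J + (ui ^ a)⁻¹ • P + ∑ l, ui ^ (b l) • Q l + ∑ m, (ui ^ (c m))⁻¹ • R m) *ᵥ vi = 0)
    (hj : (J + (uj ^ a)⁻¹ • P + ∑ l, uj ^ (b l) • Q l + ∑ m, (uj ^ (c m))⁻¹ • R m) *ᵥ vj = 0) :
    vi ⬝ᵥ ((J + (s ^ a)⁻¹ • P + ∑ l, s ^ (b l) • Q l + ∑ m, (s ^ (c m))⁻¹ • R m) *ᵥ vj)
      = (∑ l, (vi ⬝ᵥ (Q l *ᵥ vj)) * (((s ^ a)⁻¹ - (ui ^ a)⁻¹) * ((s ^ a)⁻¹ - (uj ^ a)⁻¹)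
          * (∫ ρ in Ioi (0:ℝ), ρ ^ (n l) / ((ui ^ a)⁻¹ + ρ ^ a) * (((uj ^ a)⁻¹ + ρ ^ a)⁻¹ * ((s ^ a)⁻¹ + ρ ^ a)⁻¹))
          / ∫ ρ in Ioi (0:ℝ), ρ ^ (n l) / (1 + ρ ^ a)))
        + ∑ m, (vi ⬝ᵥ (R m *ᵥ vj)) * (((s ^ a)⁻¹ - (ui ^ a)⁻¹) * ((s ^ a)⁻¹ - (uj ^ a)⁻¹)
          * (∫ ρ in Ioi (0:ℝ), ρ ^ (n' m) / ((s ^ a)⁻¹ + ρ ^ a)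
              * ((ρ ^ a * ((ui ^ a)⁻¹ + ρ ^ a)⁻¹) * (ρ ^ a * ((uj ^ a)⁻¹ + ρ ^ a)⁻¹)))
          / ∫ ρ in Ioi (0:ℝ), ρ ^ (n' m) / (1 + ρ ^ a)) := by
  have hna : ∀ l, n l + 2 ≤ a := fun l => by have := hnb l; have := hb l; omega
  have hna' : ∀ m, n' m + 2 ≤ a := fun m => by have := hnb' m; have := hb' m; omega
  have hC : ∀ l, (∫ ρ in Ioi (0:ℝ), ρ ^ (n l) / (1 + ρ ^ a)) ≠ 0 :=
    fun l => (VLawStieltjes.stieltjesConst_pos (hna l)).ne'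
  have hC' : ∀ m, (∫ ρ in Ioi (0:ℝ), ρ ^ (n' m) / (1 + ρ ^ a)) ≠ 0 :=
    fun m => (VLawStieltjes.stieltjesConst_pos (hna' m)).ne'
  have hpq : (uj ^ a)⁻¹ - (ui ^ a)⁻¹ ≠ 0 := by
    intro h
    exact hij ((pow_left_inj₀ hui.le huj.le ha.ne').1 (inv_injective (sub_eq_zero.1 h).symm))
  rw [hform₂_eq] at hi hj
  rw [hform₂_eq]
  have hoff := offdiag_identity (κ := κ ⊕ μ) hJ hP (fun x => by cases x <;> simp [hQ, hR])
    (ui ^ a)⁻¹ (uj ^ a)⁻¹ (s ^ a)⁻¹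
    (Sum.elim (fun l => ui ^ (b l)) (fun m => (ui ^ (c m))⁻¹))
    (Sum.elim (fun l => uj ^ (b l)) (fun m => (uj ^ (c m))⁻¹))
    (Sum.elim (fun l => s ^ (b l)) (fun m => (s ^ (c m))⁻¹)) hi hj
  refine mul_left_cancel₀ hpq ?_
  rw [hoff, Fintype.sum_sum_type, mul_add, Finset.mul_sum, Finset.mul_sum]
  simp only [Sum.elim_inl, Sum.elim_inr]
  congr 1
  · refine Finset.sum_congr rfl fun l _ => ?_
    have hl := offdiag_integral (hna l) (inv_pos.2 (pow_pos hui a)) (inv_pos.2 (pow_pos huj a))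
      (inv_pos.2 (pow_pos hs a)) (VLawStieltjes.integral_stieltjes_one (hnb l) hui)
      (VLawStieltjes.integral_stieltjes_one (hnb l) huj) (VLawStieltjes.integral_stieltjes_one (hnb l) hs)
    set Kl := ∫ ρ in Ioi (0:ℝ), ρ ^ (n l) / ((ui ^ a)⁻¹ + ρ ^ a) * (((uj ^ a)⁻¹ + ρ ^ a)⁻¹ * ((s ^ a)⁻¹ + ρ ^ a)⁻¹)
      with hKl
    set Cl := ∫ ρ in Ioi (0:ℝ), ρ ^ (n l) / (1 + ρ ^ a) with hCl
    have hCl' : Cl ≠ 0 := hC l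
    rw [mul_div_assoc', mul_div_assoc', eq_div_iff hCl']
    linear_combination (-(vi ⬝ᵥ (Q l *ᵥ vj))) * hl
  · refine Finset.sum_congr rfl fun m _ => ?_
    have hl := offdiag_integral₂ (hna' m) (inv_pos.2 (pow_pos hui a)) (inv_pos.2 (pow_pos huj a))
      (inv_pos.2 (pow_pos hs a)) (VLawStieltjes.integral_stieltjes_one (hnb' m) hui)
      (VLawStieltjes.integral_stieltjes_one (hnb' m) huj) (VLawStieltjes.integral_stieltjes_one (hnb' m) hs)
    rw [(sameSide_pow ha (hc m) hui).1, (sameSide_pow ha (hc m) huj).1, (sameSide_pow ha (hc m) hs).1] at hl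
    set Km := ∫ ρ in Ioi (0:ℝ), ρ ^ (n' m) / ((s ^ a)⁻¹ + ρ ^ a)
        * ((ρ ^ a * ((ui ^ a)⁻¹ + ρ ^ a)⁻¹) * (ρ ^ a * ((uj ^ a)⁻¹ + ρ ^ a)⁻¹)) with hKm
    set Cm := ∫ ρ in Ioi (0:ℝ), ρ ^ (n' m) / (1 + ρ ^ a) with hCm
    have hCm' : Cm ≠ 0 := hC' m
    rw [mul_div_assoc', mul_div_assoc', eq_div_iff hCm']
    linear_combination (-(vi ⬝ᵥ (R m *ᵥ vj))) * hl

/-- **Diagonal entry, two families.** [folklore] -/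
theorem entry_diag₂ {a : ℕ} (ha : 0 < a) {b n : κ → ℕ} (hnb : ∀ l, n l + b l + 1 = a) (hb : ∀ l, 0 < b l)
    {c n' b' : μ → ℕ} (hnb' : ∀ m, n' m + b' m + 1 = a) (hb' : ∀ m, 0 < b' m) (hc : ∀ m, c m + b' m = 2 * a)
    (J P : Matrix ι ι ℝ) (Q : κ → Matrix ι ι ℝ) (R : μ → Matrix ι ι ℝ) {ui s : ℝ} (hui : 0 < ui) (hs : 0 < s)
    {vi : ι → ℝ} (hi : (J + (ui ^ a)⁻¹ • P + ∑ l, ui ^ (b l) • Q l + ∑ m, (ui ^ (c m))⁻¹ • R m) *ᵥ vi = 0) :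
    vi ⬝ᵥ ((J + (s ^ a)⁻¹ • P + ∑ l, s ^ (b l) • Q l + ∑ m, (s ^ (c m))⁻¹ • R m) *ᵥ vi)
      = (∑ l, (vi ⬝ᵥ (Q l *ᵥ vi)) * (((s ^ a)⁻¹ - (ui ^ a)⁻¹) * ((s ^ a)⁻¹ - (ui ^ a)⁻¹)
          * (∫ ρ in Ioi (0:ℝ), ρ ^ (n l) / ((ui ^ a)⁻¹ + ρ ^ a) * (((ui ^ a)⁻¹ + ρ ^ a)⁻¹ * ((s ^ a)⁻¹ + ρ ^ a)⁻¹))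
          / ∫ ρ in Ioi (0:ℝ), ρ ^ (n l) / (1 + ρ ^ a)))
        + ∑ m, (vi ⬝ᵥ (R m *ᵥ vi)) * (((s ^ a)⁻¹ - (ui ^ a)⁻¹) * ((s ^ a)⁻¹ - (ui ^ a)⁻¹)
          * (∫ ρ in Ioi (0:ℝ), ρ ^ (n' m) / ((s ^ a)⁻¹ + ρ ^ a)
              * ((ρ ^ a * ((ui ^ a)⁻¹ + ρ ^ a)⁻¹) * (ρ ^ a * ((ui ^ a)⁻¹ + ρ ^ a)⁻¹)))
          / ∫ ρ in Ioi (0:ℝ), ρ ^ (n' m) / (1 + ρ ^ a))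
        + ((s ^ a)⁻¹ - (ui ^ a)⁻¹) * (vi ⬝ᵥ (P *ᵥ vi)
            - ∑ l, ((b l : ℝ) / a) * ui ^ (a + b l) * (vi ⬝ᵥ (Q l *ᵥ vi))
            + ∑ m, ((c m : ℝ) / a) * ui ^ a * (ui ^ (c m))⁻¹ * (vi ⬝ᵥ (R m *ᵥ vi))) := by
  have hna : ∀ l, n l + 2 ≤ a := fun l => by have := hnb l; have := hb l; omega
  have hna' : ∀ m, n' m + 2 ≤ a := fun m => by have := hnb' m; have := hb' m; omega
  have hC : ∀ l, (∫ ρ in Ioi (0:ℝ), ρ ^ (n l) / (1 + ρ ^ a)) ≠ 0 :=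
    fun l => (VLawStieltjes.stieltjesConst_pos (hna l)).ne'
  have hC' : ∀ m, (∫ ρ in Ioi (0:ℝ), ρ ^ (n' m) / (1 + ρ ^ a)) ≠ 0 :=
    fun m => (VLawStieltjes.stieltjesConst_pos (hna' m)).ne'
  rw [hform₂_eq] at hi
  rw [hform₂_eq, diag_identity (κ := κ ⊕ μ) J P _ (ui ^ a)⁻¹ (s ^ a)⁻¹ _
    (Sum.elim (fun l => s ^ (b l)) (fun m => (s ^ (c m))⁻¹)) hi, Fintype.sum_sum_type]
  simp only [Sum.elim_inl, Sum.elim_inr]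
  have hK : ∀ l, ((s ^ a)⁻¹ - (ui ^ a)⁻¹) * ((s ^ a)⁻¹ - (ui ^ a)⁻¹)
      * (∫ ρ in Ioi (0:ℝ), ρ ^ (n l) / ((ui ^ a)⁻¹ + ρ ^ a) * (((ui ^ a)⁻¹ + ρ ^ a)⁻¹ * ((s ^ a)⁻¹ + ρ ^ a)⁻¹))
      / (∫ ρ in Ioi (0:ℝ), ρ ^ (n l) / (1 + ρ ^ a))
      = s ^ (b l) - ui ^ (b l) + ((s ^ a)⁻¹ - (ui ^ a)⁻¹) * (((b l : ℝ) / a) * ui ^ (a + b l)) := by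
    intro l
    have hl := diag_integral (hna l) (inv_pos.2 (pow_pos hui a)) (inv_pos.2 (pow_pos hs a))
      (VLawStieltjes.integral_stieltjes_one (hnb l) hui) (VLawStieltjes.integral_stieltjes_one (hnb l) hs)
      (VLawStieltjes.integral_stieltjes_sq (hnb l) (hb l) hui)
    set Kl := ∫ ρ in Ioi (0:ℝ), ρ ^ (n l) / ((ui ^ a)⁻¹ + ρ ^ a) * (((ui ^ a)⁻¹ + ρ ^ a)⁻¹ * ((s ^ a)⁻¹ + ρ ^ a)⁻¹)
      with hKl
    set Cl := ∫ ρ in Ioi (0:ℝ), ρ ^ (n l) / (1 + ρ ^ a) with hCl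
    have hCl' : Cl ≠ 0 := hC l
    rw [div_eq_iff hCl']
    linear_combination hl
  have hK' : ∀ m, ((s ^ a)⁻¹ - (ui ^ a)⁻¹) * ((s ^ a)⁻¹ - (ui ^ a)⁻¹)
      * (∫ ρ in Ioi (0:ℝ), ρ ^ (n' m) / ((s ^ a)⁻¹ + ρ ^ a)
          * ((ρ ^ a * ((ui ^ a)⁻¹ + ρ ^ a)⁻¹) * (ρ ^ a * ((ui ^ a)⁻¹ + ρ ^ a)⁻¹)))
      / (∫ ρ in Ioi (0:ℝ), ρ ^ (n' m) / (1 + ρ ^ a))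
      = (s ^ (c m))⁻¹ - (ui ^ (c m))⁻¹
        - ((s ^ a)⁻¹ - (ui ^ a)⁻¹) * (((c m : ℝ) / a) * ui ^ a * (ui ^ (c m))⁻¹) := by
    intro m
    have hl := diag_integral₂ (hna' m) (inv_pos.2 (pow_pos hui a)) (inv_pos.2 (pow_pos hs a))
      (VLawStieltjes.integral_stieltjes_one (hnb' m) hui) (VLawStieltjes.integral_stieltjes_one (hnb' m) hs)
      (VLawStieltjes.integral_stieltjes_sq (hnb' m) (hb' m) hui)
    rw [(sameSide_pow ha (hc m) hui).1, (sameSide_pow ha (hc m) hs).1, (sameSide_pow ha (hc m) hui).2] at hl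
    set Km := ∫ ρ in Ioi (0:ℝ), ρ ^ (n' m) / ((s ^ a)⁻¹ + ρ ^ a)
        * ((ρ ^ a * ((ui ^ a)⁻¹ + ρ ^ a)⁻¹) * (ρ ^ a * ((ui ^ a)⁻¹ + ρ ^ a)⁻¹)) with hKm
    set Cm := ∫ ρ in Ioi (0:ℝ), ρ ^ (n' m) / (1 + ρ ^ a) with hCm
    have hCm' : Cm ≠ 0 := hC' m
    rw [div_eq_iff hCm']
    linear_combination hl
  simp_rw [hK, hK']
  have e1 : ∀ l, (vi ⬝ᵥ (Q l *ᵥ vi)) * (s ^ (b l) - ui ^ (b l)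
        + ((s ^ a)⁻¹ - (ui ^ a)⁻¹) * (((b l : ℝ) / a) * ui ^ (a + b l)))
      = (s ^ (b l) - ui ^ (b l)) * (vi ⬝ᵥ (Q l *ᵥ vi))
        + ((s ^ a)⁻¹ - (ui ^ a)⁻¹) * (((b l : ℝ) / a) * ui ^ (a + b l) * (vi ⬝ᵥ (Q l *ᵥ vi))) :=
    fun l => by ring
  have e2 : ∀ m, (vi ⬝ᵥ (R m *ᵥ vi)) * ((s ^ (c m))⁻¹ - (ui ^ (c m))⁻¹
        - ((s ^ a)⁻¹ - (ui ^ a)⁻¹) * (((c m : ℝ) / a) * ui ^ a * (ui ^ (c m))⁻¹))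
      = ((s ^ (c m))⁻¹ - (ui ^ (c m))⁻¹) * (vi ⬝ᵥ (R m *ᵥ vi))
        - ((s ^ a)⁻¹ - (ui ^ a)⁻¹) * (((c m : ℝ) / a) * ui ^ a * (ui ^ (c m))⁻¹ * (vi ⬝ᵥ (R m *ᵥ vi))) :=
    fun m => by ring
  simp_rw [e1, e2]
  rw [Finset.sum_add_distrib, Finset.sum_sub_distrib, ← Finset.mul_sum, ← Finset.mul_sum]
  ring

/-- Rearrangement of the double sum with two letter families (pure bookkeeping). [folklore] -/
theorem rearrange₂ {k : ℕ} (cc D sl : Fin k → ℝ) (Qh KQ : κ → Fin k → Fin k → ℝ) (CQ : κ → ℝ)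
    (Rh KR : μ → Fin k → Fin k → ℝ) (CR : μ → ℝ) :
    ∑ i, ∑ j, cc i * cc j * ((∑ l, Qh l i j * (D i * D j * KQ l i j / CQ l))
        + (∑ m, Rh m i j * (D i * D j * KR m i j / CR m)) + if i = j then sl i else 0)
      = (∑ l, (CQ l)⁻¹ * ∑ i, ∑ j, (cc i * D i) * (cc j * D j) * Qh l i j * KQ l i j)
        + (∑ m, (CR m)⁻¹ * ∑ i, ∑ j, (cc i * D i) * (cc j * D j) * Rh m i j * KR m i j)
        + ∑ i, cc i ^ 2 * sl i := by
  classical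
  have h1 := rearrange cc D sl Qh KQ CQ
  have h2 := rearrange cc D (fun _ => 0) Rh KR CR
  simp only [ite_self, add_zero, mul_zero, Finset.sum_const_zero] at h2
  have hsplit : ∀ i j, cc i * cc j * ((∑ l, Qh l i j * (D i * D j * KQ l i j / CQ l))
        + (∑ m, Rh m i j * (D i * D j * KR m i j / CR m)) + if i = j then sl i else 0)
      = cc i * cc j * ((∑ l, Qh l i j * (D i * D j * KQ l i j / CQ l)) + if i = j then sl i else 0)
        + cc i * cc j * (∑ m, Rh m i j * (D i * D j * KR m i j / CR m)) := fun i j => by ring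
  simp_rw [hsplit, Finset.sum_add_distrib]
  rw [h1, h2]
  ring

end Entries

end VLawCoreTwo

end Summit.ValiantsHypothesis.ValiantsHypothesis.Theorems.LacunarySymmetroidMatrixDescartes
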